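import Summits.QuantumAdvantage.QuantumAdvantage.Theorems.LightDialC3

/-! # LightDialC6 — part C6 — the witness's light threshold is EXACTLY 7: `¬ PredWPerfect n 7`

NODE «LightDial» (decomp-qadv lens-2 g26). Parts C1–C5 prove that the predecessor witness `predW` is perfect on every odd-class input of weight
`≤ 5` (even ring). This file certifies the other side of the numerical finding (g26 `num/Q-STRUCTURE.md`: "fails only at weight 7"): on the
`(6,1)` input `sixOne n` (a minority one at `0`, six majority ones at `1,3,5,7,9,11`) the witness is WRONG at every even length `n ≥ 12` —
the kernel vector is the unrolled-count vector of part C2 (sign bit `(6/2) mod 2 = 1`), the witness answers `¬x_{b+1}` on the minority class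
(`13 + 2t ≡ 1 + 2t`), and none of those answers meets the vector (`dot2 = 0`). Hence `predW_not_perfect_seven : ¬ PredWPerfect n 7` and the
exact threshold `predW_threshold : PredWPerfect n 5 ∧ ¬ PredWPerfect n 7` modulo part C5 (stated here against the `(3,2)` law of part C3 to keep
the import chain short). This says nothing about OTHER quadratic strategies at weight 7 (the law-bet `LightFail 2 7` stays UNDECIDED); rung 0.
-/

set_option linter.dupNamespace false
set_option linter.unnecessarySeqFocus false
noncomputable section
open scoped Classical

namespace Summit.QuantumAdvantage.QuantumAdvantage.Theorems.LightDial
open Finset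
open Literature.Computability.QuantumComplexity Literature.Computability.QuantumComplexity.RingHLF
open Literature.Computability.MetaComplexity Literature.Computability.MetaComplexity.Smolensky
open Summit.QuantumAdvantage.AdviceFreeQNC0
open Summit.QuantumAdvantage.QuantumAdvantage.Theorems.RingPeriodFold (kvec kernel_pair_of_oddZeros kvec_ne_zero rel_iff_of_kernel_pair)

variable {n : ℕ}

/-! ## §16 The `(6,1)` counterexample to the witness at weight 7 -/

/-- positions whose value lies in a finite set of naturals below `n`: as many as the set has elements. -/
theorem card_filter_val_mem (T : Finset ℕ) (hT : ∀ t ∈ T, t < n) :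
    (univ.filter fun i : Fin n => i.val ∈ T).card = T.card := by
  refine Finset.card_bij (fun i _ => i.val) ?_ ?_ ?_
  · intro i hi; simpa using hi
  · intro a _ b _ h; exact Fin.ext h
  · intro t ht; exact ⟨⟨t, hT t ht⟩, by simpa using ht, rfl⟩

/-- the support of the `(6,1)` input. -/
def sixOneSupp : Finset ℕ := {0, 1, 3, 5, 7, 9, 11}

/-- its six majority (odd) positions. -/
def majSix : Finset ℕ := {1, 3, 5, 7, 9, 11}

/-- the `(6,1)` input: a one at `0` (minority parity) and ones at `1, 3, 5, 7, 9, 11` (majority parity). -/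
def sixOne (n : ℕ) : Fin n → Bool := fun i => decide (i.val ∈ sixOneSupp)

/-- membership unfolding. -/
theorem sixOne_apply (i : Fin n) : sixOne n i = true ↔ i.val ∈ sixOneSupp := by simp [sixOne]

/-- the odd members of the support are the six majority positions. -/
theorem mem_majSix_iff (v : ℕ) : v ∈ majSix ↔ v ∈ sixOneSupp ∧ v % 2 = 1 := by
  simp only [majSix, sixOneSupp, mem_insert, mem_singleton]; omega

/-- the position `0`. -/
def zeroPos (h : 12 ≤ n) : Fin n := ⟨0, by omega⟩

/-- offsets from `0` are values. -/
theorem toff_zeroPos (h : 12 ≤ n) (i : Fin n) : toff (zeroPos h) i = i.val := by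
  unfold toff zeroPos; simp

/-- the majority ones of the `(6,1)` input are the positions with value in `majSix` … -/
theorem filter_sixOne_maj :
    (univ.filter fun i : Fin n => sixOne n i = true ∧ par i = 1) = univ.filter fun i : Fin n => i.val ∈ majSix := by
  ext i; simp only [mem_filter, mem_univ, true_and, sixOne_apply, mem_majSix_iff, par]

/-- … so there are six of them. -/
theorem card_sixOne_maj (h : 12 ≤ n) : (univ.filter fun i : Fin n => sixOne n i = true ∧ par i = 1).card = 6 := by
  rw [filter_sixOne_maj, card_filter_val_mem majSix (fun t ht => ?_)]
  · rfl
  · simp only [majSix, mem_insert, mem_singleton] at ht; omega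

/-- the `(6,1)` input has weight `7` … -/
theorem wt_sixOne (h : 12 ≤ n) : wt (sixOne n) = 7 := by
  unfold wt
  have e : (univ.filter fun i : Fin n => sixOne n i = true) = univ.filter fun i : Fin n => i.val ∈ sixOneSupp := by
    ext i; simp only [mem_filter, mem_univ, true_and, sixOne_apply]
  rw [e, card_filter_val_mem sixOneSupp (fun t ht => ?_)]
  · rfl
  · simp only [sixOneSupp, mem_insert, mem_singleton] at ht; omega

/-- … hence lies in the odd class of an even ring. -/
theorem oddZeros_sixOne (hn : Even n) (h : 12 ≤ n) : OddZeros (sixOne n) := by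
  have hsplit := Finset.card_filter_add_card_filter_not (s := (univ : Finset (Fin n))) (fun i : Fin n => sixOne n i = false)
  have e : (univ.filter fun i : Fin n => ¬ sixOne n i = false) = univ.filter fun i : Fin n => sixOne n i = true := by
    congr 1; ext i; simp
  rw [e, Finset.card_univ, Fintype.card_fin] at hsplit
  have hw := wt_sixOne h; unfold wt at hw
  unfold OddZeros; obtain ⟨m, hm⟩ := hn; omega

/-- the `(6,1)` input is a one-minority configuration: minority one `0`, majority parity `1`, six majority ones. -/
theorem oneMinority_sixOne (hn : Even n) (h : 12 ≤ n) : OneMinority (sixOne n) 1 (zeroPos h) where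
  even := hn
  three := by omega
  hc := by simp [sixOne, zeroPos, sixOneSupp]
  hpc := by simp [par, zeroPos]
  hmaj := by
    intro j hj hjc
    rw [sixOne_apply] at hj
    have hv : j.val ≠ 0 := fun e => hjc (Fin.ext (by simpa [zeroPos] using e))
    simp only [sixOneSupp, mem_insert, mem_singleton] at hj
    unfold par; omega
  hp2 := by norm_num
  hk := by rw [card_sixOne_maj h]; exact ⟨3, rfl⟩

/-- `13 + 2·x_{b+1} ≡ 1 ⟺ x_{b+1} = 0`: on the `(6,1)` input a minority-parity output answers the COMPLEMENT of the predecessor rule. -/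
theorem predAns_sixOne_of_par_ne (hn : Even n) (h : 12 ≤ n) {b : Fin n} (hb : par b ≠ 1) :
    predAns (sixOne n) b = !(sixOne n (nxt b)) := by
  have hO := oneMinority_sixOne hn h
  have hval : predW b (sixOne n) = ((1 : ℕ) : ZMod 3) + 2 * ((1 : ℕ) : ZMod 3) * ((6 : ℕ) : ZMod 3) +
      2 * (if sixOne n (nxt b) = true then 1 else 0) := by
    unfold predW; rw [hO.ecnt_of_par_ne hb, hO.ocnt_of_par_ne hb, card_sixOne_maj h]
  simp only [predAns, hval]
  by_cases ht : sixOne n (nxt b) = true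
  · rw [if_pos ht, ht]; decide
  · rw [if_neg ht, Bool.eq_false_iff.mpr ht]; decide

/-- the unrolled count of the `(6,1)` input at an offset `v`: the number of majority positions below `v`. -/
theorem cnt_sixOne (h : 12 ≤ n) (v : ℕ) :
    cnt (sixOne n) 1 (zeroPos h) v = (majSix.filter fun t => t < v).card := by
  unfold cnt
  have e : (univ.filter fun i : Fin n => sixOne n i = true ∧ par i = 1 ∧ toff (zeroPos h) i < v) =
      univ.filter fun i : Fin n => i.val ∈ majSix.filter fun t => t < v := by
    ext i; simp only [mem_filter, mem_univ, true_and, sixOne_apply, mem_majSix_iff, par, toff_zeroPos h]; tauto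
  rw [e, card_filter_val_mem _ (fun t ht => ?_)]
  simp only [mem_filter, majSix, mem_insert, mem_singleton] at ht; omega

/-- beyond offset `12` the count is `6` (even) … -/
theorem cnt_sixOne_of_ge (h : 12 ≤ n) {v : ℕ} (hv : 12 ≤ v) : cnt (sixOne n) 1 (zeroPos h) v = 6 := by
  rw [cnt_sixOne h, Finset.filter_true_of_mem (fun t ht => ?_)]
  · rfl
  · simp only [majSix, mem_insert, mem_singleton] at ht; omega

/-- … and below `12` every even offset precedes a majority one. -/
theorem succ_mem_majSix {v : ℕ} (hv : v < 12) (he : v % 2 = 0) : v + 1 ∈ majSix := by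
  simp only [majSix, mem_insert, mem_singleton]; omega

/-- ★ THE WITNESS IS WRONG ON THE `(6,1)` INPUT (every even `n ≥ 12`): the kernel vector is the unrolled-count vector (sign bit `1`), the witness
answers `¬x_{b+1}` on the minority class, and no such answer meets the vector. -/
theorem not_rel_sixOne (hn : Even n) (h : 12 ≤ n) : ¬ Rel (sixOne n) (predAns (sixOne n)) := by
  have hO := oneMinority_sixOne hn h
  have hx := oddZeros_sixOne hn h
  have hK := kernel_pair_of_oddZeros hO.three hx
  rw [rel_iff_of_kernel_pair (sixOne n) (kvec (sixOne n)) _ hK, hO.kvec_eq_cntVec hx, hO.signBit_cntVec, card_sixOne_maj h]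
  have hempty : (univ.filter fun i : Fin n => cntVec (sixOne n) 1 (zeroPos h) i = true ∧ predAns (sixOne n) i = true) = ∅ := by
    rw [Finset.filter_eq_empty_iff]
    rintro i _ ⟨hV, hz⟩
    by_cases hpi : par i = 1
    · rw [hO.predAns_of_par_eq hpi] at hz; exact Bool.false_ne_true hz
    · rw [predAns_sixOne_of_par_ne hn h hpi] at hz
      have hnx : sixOne n (nxt i) = false := by simpa using hz
      have hVi : cnt (sixOne n) 1 (zeroPos h) i.val % 2 = 1 := by
        simpa [cntVec, hpi, toff_zeroPos h] using hV
      have hi2 : i.val % 2 = 0 := by unfold par at hpi; omega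
      by_cases hlt : i.val < 12
      · -- below 12: the successor is a majority one, so the witness answered `true` there — contradiction with `hnx`
        have hil : i.val + 1 < n := by omega
        have hmem := succ_mem_majSix hlt hi2
        have : sixOne n (nxt i) = true := by
          rw [sixOne_apply, show (nxt i).val = i.val + 1 by rw [nxt_val_eq, if_pos hil]]
          exact ((mem_majSix_iff _).mp hmem).1
        rw [hnx] at this; exact Bool.false_ne_true this
      · -- beyond 12: the count is 6, the vector misses `i`
        rw [cnt_sixOne_of_ge h (by omega)] at hVi; omega
  unfold dot2; rw [hempty]; simp

/-- ★★ THE WITNESS'S LIGHT THRESHOLD IS AT MOST 7: `¬ PredWPerfect n 7` at every even length `n ≥ 12`. -/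
theorem predW_not_perfect_seven (hn : Even n) (h : 12 ≤ n) : ¬ PredWPerfect n 7 :=
  fun hP => not_rel_sixOne hn h (hP (sixOne n) (oddZeros_sixOne hn h) (by rw [wt_sixOne h]))

/-- ★★ … AND EXACTLY 7 given the `(3,2)` law of part C3 (proved in part C5): perfect to weight 5, imperfect at weight 7. -/
theorem predW_threshold (hn : Even n) (h : 12 ≤ n) (h32 : Pred32Law n) : PredWPerfect n 5 ∧ ¬ PredWPerfect n 7 :=
  ⟨predWPerfect_five_of_law32 hn (by omega) h32, predW_not_perfect_seven hn h⟩

end Summit.QuantumAdvantage.QuantumAdvantage.Theorems.LightDial
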